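import Summits.AtomisticToContinuum.HydrodynamicLimit.Theorems.InformationPercolationEngineKickFairRelEquilibriumMesoCutCore
import Summits.AtomisticToContinuum.HydrodynamicLimit.Theorems.InformationPercolationEngineKickFairRelEquilibriumMesoPastMeasurable
import HarnessLib

/-!
# `KickFairRelEquilibriumMeso`, line `Sketch` — ONE restart stub: the UNCENTRED deviation bound RU implies R-i″ and R-ii″
# (crux stmt-AtomisticToContinuum-15177; `--supports`; continuation lead c4, rev 10 reshape, 2026-08-16)

Helper file of the line `Cruxes/KickFairRelEquilibriumMeso/Lines/Sketch.lean`. At rev 9 the landed glue `cutTransfer`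
(p124022) machine-checks `crux ⇐ U ∧ R-i″ ∧ R-ii″`, where, on level sets `B` of the time-zero key carrying `LG`-mass
`≥ e^{-η(N+1)}`, for CUT weight families and kinetic windows `(t₁, t₂] ⊆ [0, τ]` of length `≤ t_N`, under the invariant law
`G = localGibbsLaw σ 1 0 1 N (Φ N)` and with `Z` the windowed `κ`-centred kick sum `slotSum`:

* R-i″ `stub_restartBiasCut`: `|E_G[Z; B]| ≤ δ t_N G(B)` (first moment);
* R-ii″ `stub_restartConcentrationCut`: `G(B ∩ {|Z − m_B| > t_N/L}) ≤ e^{-c(N+1)} G(B)`, `m_B = E_G[Z; B]/G(B)` (centred deviation).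

This file proves that BOTH follow from the single UNCENTRED deviation bound (rev 10 stub RU `stub_restartDeviationCut`)

    G(B ∩ {|Z| > t_N/L}) ≤ e^{-c(N+1)} G(B)        (same quantifier prefix as R-ii″),

so that the skeleton of the line reads `crux ⇐ U ∧ RU` with everything else landed (classification memo of lead c2,
`Lines/Sketch.md` §3: the uncentred merged form is `R-i″ ∧ R-ii″-evolved`, branch-uniform one-sided chaos for the cut windowed
kick sum under the pinched invariant law — the single Boltzmann-hypothesis-class statement of the line).

* `setIntegral_abs_slotSum_le_of_deviation` (fixed `N`, the first moment from a deviation bound): with the pointwise cut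
  bound `|Z| ≤ 2C(A+1)ε_N` on the good set (`abs_slotSum_le_of_cut`, at most `A+1` long-flight collisions per sphere per
  kinetic window) and `G(goodᶜ) = 0`, `∫_B |Z| dG ≤ (t_N/L) G(B) + 2C(A+1)ε_N · G(B ∩ {|Z| > t_N/L})`.
* `restartBiasCut_of_deviationCut` (RU ⇒ R-i″, registered signatures verbatim): `L = 2/δ`, and `2C(A+1)σ e^{-c(N+1)} ≤ δ/2`
  eventually (`ε_N = σ t_N`).
* `restartConcentrationCut_of_deviationCut` (RU ⇒ R-ii″, verbatim): RU at `2L` for the deviation and, through the first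
  moment, `|m_B| ≤ t_N/(2L)` eventually, so `{|Z − m_B| > t_N/L} ⊆ {|Z| > t_N/(2L)}`.

All hypotheses are explicit binders; no named `Prop` is taken as a fact.
-/

noncomputable section

open MeasureTheory Set Filter Topology
open scoped ENNReal Classical

namespace Summit.AtomisticToContinuum.HydrodynamicLimit.Theorems.KickFairRelEquilibriumMesoLine

open Literature.Analysis.FluidPDE Literature.MathematicalPhysics.KineticTheory

variable {σ : ℝ} {N : ℕ}

/-! ## Small inputs -/

/-- **Eventual smallness of `K e^{-c(N+1)}`**: for `c > 0` and every `K, b` with `0 < b` there is `N₀` with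
`K · e^{-c(N+1)} ≤ b` for `N ≥ N₀`. [folklore] -/
theorem exists_nat_const_mul_exp_neg_le (K : ℝ) {c b : ℝ} (hc : 0 < c) (hb : 0 < b) :
    ∃ N₀ : ℕ, ∀ N : ℕ, N₀ ≤ N → K * Real.exp (-(c * ((N : ℝ) + 1))) ≤ b := by
  have h1 : Tendsto (fun N : ℕ => c * ((N : ℝ) + 1)) atTop atTop :=
    (tendsto_atTop_add_const_right _ 1 tendsto_natCast_atTop_atTop).const_mul_atTop hc
  have h2 : Tendsto (fun N : ℕ => Real.exp (-(c * ((N : ℝ) + 1)))) atTop (𝓝 0) :=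
    Real.tendsto_exp_atBot.comp (tendsto_neg_atTop_atBot.comp h1)
  have h3 : Tendsto (fun N : ℕ => K * Real.exp (-(c * ((N : ℝ) + 1)))) atTop (𝓝 0) := by
    simpa using h2.const_mul K
  have h4 : ∀ᶠ N : ℕ in atTop, K * Real.exp (-(c * ((N : ℝ) + 1))) < b := (tendsto_order.1 h3).2 b hb
  obtain ⟨N₀, hN₀⟩ := eventually_atTop.1 h4
  exact ⟨N₀, fun N hN => (hN₀ N hN).le⟩

/-! ## The first moment from an uncentred deviation bound (fixed `N`) -/

section FixedN

variable {Φ : Flow σ N}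

/-- **First moment from a deviation bound (fixed `N`).** For a cut weight family, a window of length `≤ t_N`, `|g| ≤ C`,
a measurable set `B` and a level `t_N/L`: `∫_B |Z| dG ≤ (t_N/L)·G(B) + 2C(A+1)ε_N · G(B ∩ {|Z| > t_N/L})` under the invariant
law `G` — split `B` along `{|Z| > t_N/L}` (through the measurable good-set version of `Z`), use `|Z| ≤ t_N/L` off it and the
pointwise cut bound `|Z| ≤ 2C(A+1)ε_N` (`abs_slotSum_le_of_cut`, `G`-a.e.: good set and `|κ| ≤ C`) on it. [folklore] -/
theorem setIntegral_abs_slotSum_le_of_deviation (hPM : PastMeasurable) (hσ : 0 < σ) (hσ2 : σ ≤ 1 / 2)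
    (τ : ℝ) {t₁ t₂ A : ℝ} (hA : 0 < A) (hlen : t₂ ≤ t₁ + tN N)
    {g : V3 × V3 × V3 → ℝ} (hg : Continuous g) {C : ℝ} (hCg : ∀ p, |g p| ≤ C)
    {h : Fin (N + 1) → ℕ → Past N → ℝ} (hh : ∀ i n, Measurable (h i n)) (hhb : ∀ i n p, |h i n p| ≤ 1)
    (hcut : ∀ i n p, p.2.2.2 - p.2.1 < tN N / A → h i n p = 0)
    {B : Set (Phase N)} (hB : MeasurableSet B) {L : ℝ} (hL : 0 < L) :
    ∫ z in B, |slotSum Φ τ (rs N) t₁ t₂ g h z| ∂(localGibbsLaw σ (fun _ => 1) (fun _ => 0) (fun _ => 1) N Φ) ≤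
      tN N / L * (localGibbsLaw σ (fun _ => 1) (fun _ => 0) (fun _ => 1) N Φ B).toReal +
        2 * C * (A + 1) * hsDiameter σ N *
          (localGibbsLaw σ (fun _ => 1) (fun _ => 0) (fun _ => 1) N Φ
            (B ∩ {z | tN N / L < |slotSum Φ τ (rs N) t₁ t₂ g h z|})).toReal := by
  set ν : Measure (Phase N) := localGibbsLaw σ (fun _ => 1) (fun _ => 0) (fun _ => 1) N Φ with hνdef
  haveI : IsProbabilityMeasure ν := isProbabilityMeasure_localGibbsLaw continuous_const continuous_const
    continuous_const (fun _ => one_pos) (fun _ => one_pos) hσ2 N Φ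
  set Z : Phase N → ℝ := slotSum Φ τ (rs N) t₁ t₂ g h with hZdef
  set Z' : Phase N → ℝ := slotSumGood Φ τ (rs N) t₁ t₂ g h with hZ'def
  set β : ℝ := 2 * C * (A + 1) * hsDiameter σ N with hβdef
  have hC0 : 0 ≤ C := (abs_nonneg _).trans (hCg 0)
  have hβ0 : 0 ≤ β := by
    have := (hsDiameter_pos hσ N).le
    positivity
  have htL : 0 ≤ tN N / L := div_nonneg (tN_pos N).le hL.le
  -- measurability of the good-set version and a.e. agreement
  have hZ'm : Measurable Z' := measurable_slotSumGood hPM hσ Φ τ (rs N) t₁ t₂ hg hh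
  have hνg : ν Φ.goodᶜ = 0 := localGibbsLaw_compl_good_eq_zero Φ
  have hgood : ∀ᵐ z ∂ν, z ∈ Φ.good := mem_ae_iff.2 hνg
  have hZZ' : ∀ᵐ z ∂ν, Z z = Z' z := by
    filter_upwards [hgood] with z hz using slotSum_eq_slotSumGood_of_mem_good Φ τ (rs N) t₁ t₂ g h hz
  -- the a.e. pointwise cut bound
  have hκ : ∀ᵐ z ∂ν, ∀ i : Fin (N + 1), ∀ n : ℕ, |kappa Φ (rs N) g i n z| ≤ C :=
    ae_forall_abs_kappa_le Φ (rs N) hCg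
  have hZβ : ∀ᵐ z ∂ν, |Z z| ≤ β := by
    filter_upwards [hgood, hκ] with z hz hκz
    exact abs_slotSum_le_of_cut Φ hσ τ (rs N) hA hlen hCg hhb hcut hz hκz
  have hZ'β : ∀ᵐ z ∂ν, |Z' z| ≤ β := by
    filter_upwards [hZβ, hZZ'] with z h1 h2
    rwa [← h2]
  -- the measurable deviation set
  set E' : Set (Phase N) := {z | tN N / L < |Z' z|} with hE'def
  have hE'm : MeasurableSet E' := measurableSet_lt measurable_const (continuous_abs.measurable.comp hZ'm)
  -- its mass is at most that of the true deviation set (they agree on the good set)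
  have hEsub : B ∩ E' ⊆ (B ∩ {z | tN N / L < |Z z|}) ∪ Φ.goodᶜ := by
    intro z hz
    by_cases hzg : z ∈ Φ.good
    · left
      refine ⟨hz.1, ?_⟩
      have := hz.2
      simp only [hE'def, mem_setOf_eq] at this ⊢
      rwa [hZdef, slotSum_eq_slotSumGood_of_mem_good Φ τ (rs N) t₁ t₂ g h hzg]
    · right; exact hzg
  have hEmass : ν (B ∩ E') ≤ ν (B ∩ {z | tN N / L < |Z z|}) := by
    calc ν (B ∩ E') ≤ ν ((B ∩ {z | tN N / L < |Z z|}) ∪ Φ.goodᶜ) := measure_mono hEsub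
      _ ≤ ν (B ∩ {z | tN N / L < |Z z|}) + ν Φ.goodᶜ := measure_union_le _ _
      _ = ν (B ∩ {z | tN N / L < |Z z|}) := by rw [hνg, add_zero]
  -- integrability of |Z'|
  have hZ'i : Integrable (fun z => |Z' z|) ν := by
    refine Integrable.of_bound (continuous_abs.measurable.comp hZ'm).aestronglyMeasurable β ?_
    filter_upwards [hZ'β] with z hz
    rwa [Real.norm_eq_abs, abs_abs]
  -- ∫_B |Z| = ∫_B |Z'| = ∫_{B ∩ E'} |Z'| + ∫_{B \ E'} |Z'|
  have hcongr : ∫ z in B, |Z z| ∂ν = ∫ z in B, |Z' z| ∂ν := by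
    refine setIntegral_congr_ae hB ?_
    filter_upwards [hZZ'] with z hz _
    rw [hz]
  have hsplit : ∫ z in B ∩ E', |Z' z| ∂ν + ∫ z in B \ E', |Z' z| ∂ν = ∫ z in B, |Z' z| ∂ν :=
    integral_inter_add_sdiff hE'm hZ'i.integrableOn
  -- on B ∩ E': the constant β
  have hI1 : ∫ z in B ∩ E', |Z' z| ∂ν ≤ β * (ν (B ∩ E')).toReal := by
    calc ∫ z in B ∩ E', |Z' z| ∂ν ≤ ∫ _ in B ∩ E', β ∂ν := by
          refine setIntegral_mono_ae hZ'i.integrableOn (integrableOn_const (hs := by finiteness)) ?_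
          exact hZ'β
      _ = β * (ν (B ∩ E')).toReal := by
          rw [setIntegral_const, smul_eq_mul, mul_comm, measureReal_def]
  -- on B \ E': the constant t_N / L
  have hI2 : ∫ z in B \ E', |Z' z| ∂ν ≤ tN N / L * (ν B).toReal := by
    calc ∫ z in B \ E', |Z' z| ∂ν ≤ ∫ _ in B \ E', tN N / L ∂ν := by
          refine setIntegral_mono_on hZ'i.integrableOn (integrableOn_const (hs := by finiteness))
            (hB.diff hE'm) fun z hz => ?_
          have := hz.2
          simp only [hE'def, mem_setOf_eq, not_lt] at this
          exact this
      _ = tN N / L * (ν (B \ E')).toReal := by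
          rw [setIntegral_const, smul_eq_mul, mul_comm, measureReal_def]
      _ ≤ tN N / L * (ν B).toReal := by
          refine mul_le_mul_of_nonneg_left ?_ htL
          exact ENNReal.toReal_mono (measure_ne_top _ _) (measure_mono Set.sdiff_subset)
  -- assemble
  have hmass' : (ν (B ∩ E')).toReal ≤ (ν (B ∩ {z | tN N / L < |Z z|})).toReal :=
    ENNReal.toReal_mono (measure_ne_top _ _) hEmass
  calc ∫ z in B, |Z z| ∂ν = ∫ z in B ∩ E', |Z' z| ∂ν + ∫ z in B \ E', |Z' z| ∂ν := by
        rw [hcongr, hsplit]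
    _ ≤ β * (ν (B ∩ E')).toReal + tN N / L * (ν B).toReal := add_le_add hI1 hI2
    _ ≤ β * (ν (B ∩ {z | tN N / L < |Z z|})).toReal + tN N / L * (ν B).toReal := by
        gcongr
    _ = _ := by rw [add_comm]

/-- **Corollary (fixed `N`): first moment from a RELATIVE deviation bound.** If moreover
`G(B ∩ {|Z| > t_N/L}) ≤ e^{-c(N+1)} G(B)`, then `|∫_B Z dG| ≤ (1/L + 2C(A+1)σ e^{-c(N+1)}) t_N G(B)`. [folklore] -/
theorem abs_setIntegral_slotSum_le_of_relDeviation (hPM : PastMeasurable) (hσ : 0 < σ) (hσ2 : σ ≤ 1 / 2)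
    (τ : ℝ) {t₁ t₂ A : ℝ} (hA : 0 < A) (hlen : t₂ ≤ t₁ + tN N)
    {g : V3 × V3 × V3 → ℝ} (hg : Continuous g) {C : ℝ} (hCg : ∀ p, |g p| ≤ C)
    {h : Fin (N + 1) → ℕ → Past N → ℝ} (hh : ∀ i n, Measurable (h i n)) (hhb : ∀ i n p, |h i n p| ≤ 1)
    (hcut : ∀ i n p, p.2.2.2 - p.2.1 < tN N / A → h i n p = 0)
    {B : Set (Phase N)} (hB : MeasurableSet B) {L : ℝ} (hL : 0 < L) {c : ℝ}
    (hdev : localGibbsLaw σ (fun _ => 1) (fun _ => 0) (fun _ => 1) N Φ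
        (B ∩ {z | tN N / L < |slotSum Φ τ (rs N) t₁ t₂ g h z|}) ≤
      ENNReal.ofReal (Real.exp (-(c * ((N : ℝ) + 1)))) * localGibbsLaw σ (fun _ => 1) (fun _ => 0) (fun _ => 1) N Φ B) :
    |∫ z in B, slotSum Φ τ (rs N) t₁ t₂ g h z ∂(localGibbsLaw σ (fun _ => 1) (fun _ => 0) (fun _ => 1) N Φ)| ≤
      (1 / L + 2 * C * (A + 1) * σ * Real.exp (-(c * ((N : ℝ) + 1)))) * tN N *
        (localGibbsLaw σ (fun _ => 1) (fun _ => 0) (fun _ => 1) N Φ B).toReal := by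
  set ν : Measure (Phase N) := localGibbsLaw σ (fun _ => 1) (fun _ => 0) (fun _ => 1) N Φ with hνdef
  haveI : IsProbabilityMeasure ν := isProbabilityMeasure_localGibbsLaw continuous_const continuous_const
    continuous_const (fun _ => one_pos) (fun _ => one_pos) hσ2 N Φ
  have hC0 : 0 ≤ C := (abs_nonneg _).trans (hCg 0)
  have hε : hsDiameter σ N = σ * tN N := by
    unfold hsDiameter tN; push_cast; ring_nf
  have h1 := setIntegral_abs_slotSum_le_of_deviation (Φ := Φ) hPM hσ hσ2 τ hA hlen hg hCg hh hhb hcut hB hL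
  have hmass : (ν (B ∩ {z | tN N / L < |slotSum Φ τ (rs N) t₁ t₂ g h z|})).toReal ≤
      Real.exp (-(c * ((N : ℝ) + 1))) * (ν B).toReal := by
    have := ENNReal.toReal_mono (ENNReal.mul_ne_top ENNReal.ofReal_ne_top (measure_ne_top _ _)) hdev
    rwa [ENNReal.toReal_mul, ENNReal.toReal_ofReal (Real.exp_pos _).le] at this
  calc |∫ z in B, slotSum Φ τ (rs N) t₁ t₂ g h z ∂ν|
      ≤ ∫ z in B, |slotSum Φ τ (rs N) t₁ t₂ g h z| ∂ν := abs_integral_le_integral_abs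
    _ ≤ tN N / L * (ν B).toReal + 2 * C * (A + 1) * hsDiameter σ N *
          (ν (B ∩ {z | tN N / L < |slotSum Φ τ (rs N) t₁ t₂ g h z|})).toReal := h1
    _ ≤ tN N / L * (ν B).toReal + 2 * C * (A + 1) * hsDiameter σ N *
          (Real.exp (-(c * ((N : ℝ) + 1))) * (ν B).toReal) := by
        have : 0 ≤ 2 * C * (A + 1) * hsDiameter σ N := by
          have := (hsDiameter_pos hσ N).le; positivity
        gcongr
    _ = (1 / L + 2 * C * (A + 1) * σ * Real.exp (-(c * ((N : ℝ) + 1)))) * tN N * (ν B).toReal := by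
        rw [hε]; ring

end FixedN

/-! ## RU ⇒ R-i″ and RU ⇒ R-ii″ (registered signatures verbatim) -/

/-- **RU ⇒ R-i″ (`stub_restartBiasCut` from the uncentred deviation stub `stub_restartDeviationCut`).** Given `δ, A`, apply RU
at `L = 2/δ`; the first moment (`abs_setIntegral_slotSum_le_of_relDeviation`) is
`≤ (δ/2 + 2C(A+1)σ e^{-c(N+1)}) t_N G(B) ≤ δ t_N G(B)` eventually (`exists_nat_const_mul_exp_neg_le`). The Borel plumbing M is
taken as an explicit hypothesis (discharged by the landed `stub_pastMeasurable` at the call site). [folklore] -/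
theorem restartBiasCut_of_deviationCut :
    PastMeasurable →
    (∀ (a₀ θ₀ : T3 → ℝ) (u₀ : T3 → V3), Continuous a₀ → Continuous θ₀ → Continuous u₀ →
      (∀ x, 0 < a₀ x) → (∀ x, 0 < θ₀ x) →
      ∃ σ₀ : ℝ, 0 < σ₀ ∧ ∀ σ : ℝ, 0 < σ → σ < σ₀ → ∀ Φ : (N : ℕ) → Flow σ N, ∀ τ : ℝ, 0 < τ →
      ∀ g : V3 × V3 × V3 → ℝ, Continuous g → (∃ C : ℝ, ∀ p, |g p| ≤ C) →
      ∀ L : ℝ, 0 < L → ∀ A : ℝ, 0 < A →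
      ∃ c : ℝ, 0 < c ∧ ∃ η : ℝ, 0 < η ∧ ∃ N₀ : ℕ, ∀ N : ℕ, N₀ ≤ N →
      ∀ h : Fin (N + 1) → ℕ → Past N → ℝ, (∀ i n, Measurable (h i n)) → (∀ i n p, |h i n p| ≤ 1) →
      (∀ i n p, p.2.2.2 - p.2.1 < tN N / A → h i n p = 0) →
      ∀ t₁ t₂ : ℝ, 0 ≤ t₁ → t₁ ≤ t₂ → t₂ ≤ τ → t₂ ≤ t₁ + tN N →
      ∀ z₀ : Phase N,
      ENNReal.ofReal (Real.exp (-(η * ((N : ℝ) + 1)))) ≤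
          localGibbsLaw σ a₀ u₀ θ₀ N (Φ N) {z | cellKey (rs N) (rs N) z = cellKey (rs N) (rs N) z₀} →
        localGibbsLaw σ (fun _ => 1) (fun _ => 0) (fun _ => 1) N (Φ N)
            ({z | cellKey (rs N) (rs N) z = cellKey (rs N) (rs N) z₀} ∩
              {z | tN N / L < |slotSum (Φ N) τ (rs N) t₁ t₂ g h z|}) ≤
          ENNReal.ofReal (Real.exp (-(c * ((N : ℝ) + 1)))) *
            localGibbsLaw σ (fun _ => 1) (fun _ => 0) (fun _ => 1) N (Φ N)
              {z | cellKey (rs N) (rs N) z = cellKey (rs N) (rs N) z₀}) →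
    ∀ (a₀ θ₀ : T3 → ℝ) (u₀ : T3 → V3), Continuous a₀ → Continuous θ₀ → Continuous u₀ →
    (∀ x, 0 < a₀ x) → (∀ x, 0 < θ₀ x) →
    ∃ σ₀ : ℝ, 0 < σ₀ ∧ ∀ σ : ℝ, 0 < σ → σ < σ₀ → ∀ Φ : (N : ℕ) → Flow σ N, ∀ τ : ℝ, 0 < τ →
    ∀ g : V3 × V3 × V3 → ℝ, Continuous g → (∃ C : ℝ, ∀ p, |g p| ≤ C) →
    ∀ δ : ℝ, 0 < δ → ∀ A : ℝ, 0 < A →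
    ∃ η : ℝ, 0 < η ∧ ∃ N₀ : ℕ, ∀ N : ℕ, N₀ ≤ N →
    ∀ h : Fin (N + 1) → ℕ → Past N → ℝ, (∀ i n, Measurable (h i n)) → (∀ i n p, |h i n p| ≤ 1) →
    (∀ i n p, p.2.2.2 - p.2.1 < tN N / A → h i n p = 0) →
    ∀ t₁ t₂ : ℝ, 0 ≤ t₁ → t₁ ≤ t₂ → t₂ ≤ τ → t₂ ≤ t₁ + tN N →
    ∀ z₀ : Phase N,
    ENNReal.ofReal (Real.exp (-(η * ((N : ℝ) + 1)))) ≤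
        localGibbsLaw σ a₀ u₀ θ₀ N (Φ N) {z | cellKey (rs N) (rs N) z = cellKey (rs N) (rs N) z₀} →
      |∫ z in {z | cellKey (rs N) (rs N) z = cellKey (rs N) (rs N) z₀}, slotSum (Φ N) τ (rs N) t₁ t₂ g h z
          ∂(localGibbsLaw σ (fun _ => 1) (fun _ => 0) (fun _ => 1) N (Φ N))| ≤
        δ * tN N * (localGibbsLaw σ (fun _ => 1) (fun _ => 0) (fun _ => 1) N (Φ N)
          {z | cellKey (rs N) (rs N) z = cellKey (rs N) (rs N) z₀}).toReal := by
  intro hPM hRU a₀ θ₀ u₀ ha hθ hu ha0 hθ0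
  obtain ⟨σ₁, hσ₁, hRU⟩ := hRU a₀ θ₀ u₀ ha hθ hu ha0 hθ0
  refine ⟨min σ₁ (1 / 2), lt_min hσ₁ (by norm_num), fun σ hσ hσlt Φ τ hτ g hg hgb δ hδ A hA => ?_⟩
  have hσ₁' : σ < σ₁ := hσlt.trans_le (min_le_left _ _)
  have hσ2 : σ ≤ 1 / 2 := (hσlt.trans_le (min_le_right _ _)).le
  obtain ⟨C, hCg⟩ := hgb
  have hC0 : 0 ≤ C := (abs_nonneg _).trans (hCg 0)
  have hL : (0 : ℝ) < 2 / δ := by positivity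
  obtain ⟨c, hc, η, hη, N₁, hdev⟩ := hRU σ hσ hσ₁' Φ τ hτ g hg ⟨C, hCg⟩ (2 / δ) hL A hA
  obtain ⟨N₂, hN₂⟩ := exists_nat_const_mul_exp_neg_le (2 * C * (A + 1) * σ) hc (half_pos hδ)
  refine ⟨η, hη, max N₁ N₂, fun N hN h hh hhb hcut t₁ t₂ ht₁ h12 ht₂τ hlen z₀ hB => ?_⟩
  have hN₁ : N₁ ≤ N := le_trans (le_max_left _ _) hN
  have hN₂' : N₂ ≤ N := le_trans (le_max_right _ _) hN
  have hdevN := hdev N hN₁ h hh hhb hcut t₁ t₂ ht₁ h12 ht₂τ hlen z₀ hB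
  have key := abs_setIntegral_slotSum_le_of_relDeviation hPM hσ hσ2 τ hA hlen hg hCg hh hhb hcut
    (measurableSet_cellKey_eq (rs N) (rs N) (cellKey (rs N) (rs N) z₀)) hL hdevN
  refine key.trans ?_
  have hG0 : 0 ≤ (localGibbsLaw σ (fun _ => 1) (fun _ => 0) (fun _ => 1) N (Φ N)
      {z | cellKey (rs N) (rs N) z = cellKey (rs N) (rs N) z₀}).toReal := ENNReal.toReal_nonneg
  have htN := (tN_pos N).le
  have hsmall := hN₂ N hN₂'
  have hcoef : 1 / (2 / δ) + 2 * C * (A + 1) * σ * Real.exp (-(c * ((N : ℝ) + 1))) ≤ δ := by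
    rw [one_div_div]
    linarith
  exact mul_le_mul_of_nonneg_right (mul_le_mul_of_nonneg_right hcoef htN) hG0

/-- **RU ⇒ R-ii″ (`stub_restartConcentrationCut` from the uncentred deviation stub `stub_restartDeviationCut`).** Given
`L, A`: RU at `2L` bounds `G(B ∩ {|Z| > t_N/(2L)})`; RU at `8L` and the first moment give `|E_G[Z; B]| ≤ (t_N/(2L)) G(B)`
eventually, hence `|m_B| ≤ t_N/(2L)` and `{|Z − m_B| > t_N/L} ⊆ {|Z| > t_N/(2L)}`. [folklore] -/
theorem restartConcentrationCut_of_deviationCut :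
    PastMeasurable →
    (∀ (a₀ θ₀ : T3 → ℝ) (u₀ : T3 → V3), Continuous a₀ → Continuous θ₀ → Continuous u₀ →
      (∀ x, 0 < a₀ x) → (∀ x, 0 < θ₀ x) →
      ∃ σ₀ : ℝ, 0 < σ₀ ∧ ∀ σ : ℝ, 0 < σ → σ < σ₀ → ∀ Φ : (N : ℕ) → Flow σ N, ∀ τ : ℝ, 0 < τ →
      ∀ g : V3 × V3 × V3 → ℝ, Continuous g → (∃ C : ℝ, ∀ p, |g p| ≤ C) →
      ∀ L : ℝ, 0 < L → ∀ A : ℝ, 0 < A →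
      ∃ c : ℝ, 0 < c ∧ ∃ η : ℝ, 0 < η ∧ ∃ N₀ : ℕ, ∀ N : ℕ, N₀ ≤ N →
      ∀ h : Fin (N + 1) → ℕ → Past N → ℝ, (∀ i n, Measurable (h i n)) → (∀ i n p, |h i n p| ≤ 1) →
      (∀ i n p, p.2.2.2 - p.2.1 < tN N / A → h i n p = 0) →
      ∀ t₁ t₂ : ℝ, 0 ≤ t₁ → t₁ ≤ t₂ → t₂ ≤ τ → t₂ ≤ t₁ + tN N →
      ∀ z₀ : Phase N,
      ENNReal.ofReal (Real.exp (-(η * ((N : ℝ) + 1)))) ≤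
          localGibbsLaw σ a₀ u₀ θ₀ N (Φ N) {z | cellKey (rs N) (rs N) z = cellKey (rs N) (rs N) z₀} →
        localGibbsLaw σ (fun _ => 1) (fun _ => 0) (fun _ => 1) N (Φ N)
            ({z | cellKey (rs N) (rs N) z = cellKey (rs N) (rs N) z₀} ∩
              {z | tN N / L < |slotSum (Φ N) τ (rs N) t₁ t₂ g h z|}) ≤
          ENNReal.ofReal (Real.exp (-(c * ((N : ℝ) + 1)))) *
            localGibbsLaw σ (fun _ => 1) (fun _ => 0) (fun _ => 1) N (Φ N)
              {z | cellKey (rs N) (rs N) z = cellKey (rs N) (rs N) z₀}) →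
    ∀ (a₀ θ₀ : T3 → ℝ) (u₀ : T3 → V3), Continuous a₀ → Continuous θ₀ → Continuous u₀ →
    (∀ x, 0 < a₀ x) → (∀ x, 0 < θ₀ x) →
    ∃ σ₀ : ℝ, 0 < σ₀ ∧ ∀ σ : ℝ, 0 < σ → σ < σ₀ → ∀ Φ : (N : ℕ) → Flow σ N, ∀ τ : ℝ, 0 < τ →
    ∀ g : V3 × V3 × V3 → ℝ, Continuous g → (∃ C : ℝ, ∀ p, |g p| ≤ C) →
    ∀ L : ℝ, 0 < L → ∀ A : ℝ, 0 < A →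
    ∃ c : ℝ, 0 < c ∧ ∃ η : ℝ, 0 < η ∧ ∃ N₀ : ℕ, ∀ N : ℕ, N₀ ≤ N →
    ∀ h : Fin (N + 1) → ℕ → Past N → ℝ, (∀ i n, Measurable (h i n)) → (∀ i n p, |h i n p| ≤ 1) →
    (∀ i n p, p.2.2.2 - p.2.1 < tN N / A → h i n p = 0) →
    ∀ t₁ t₂ : ℝ, 0 ≤ t₁ → t₁ ≤ t₂ → t₂ ≤ τ → t₂ ≤ t₁ + tN N →
    ∀ z₀ : Phase N,
    ENNReal.ofReal (Real.exp (-(η * ((N : ℝ) + 1)))) ≤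
        localGibbsLaw σ a₀ u₀ θ₀ N (Φ N) {z | cellKey (rs N) (rs N) z = cellKey (rs N) (rs N) z₀} →
      localGibbsLaw σ (fun _ => 1) (fun _ => 0) (fun _ => 1) N (Φ N)
          ({z | cellKey (rs N) (rs N) z = cellKey (rs N) (rs N) z₀} ∩
            {z | tN N / L < |slotSum (Φ N) τ (rs N) t₁ t₂ g h z -
              (localGibbsLaw σ (fun _ => 1) (fun _ => 0) (fun _ => 1) N (Φ N)
                  {z | cellKey (rs N) (rs N) z = cellKey (rs N) (rs N) z₀}).toReal⁻¹ *
                ∫ z in {z | cellKey (rs N) (rs N) z = cellKey (rs N) (rs N) z₀}, slotSum (Φ N) τ (rs N) t₁ t₂ g h z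
                  ∂(localGibbsLaw σ (fun _ => 1) (fun _ => 0) (fun _ => 1) N (Φ N))|}) ≤
        ENNReal.ofReal (Real.exp (-(c * ((N : ℝ) + 1)))) *
          localGibbsLaw σ (fun _ => 1) (fun _ => 0) (fun _ => 1) N (Φ N)
            {z | cellKey (rs N) (rs N) z = cellKey (rs N) (rs N) z₀} := by
  intro hPM hRU a₀ θ₀ u₀ ha hθ hu ha0 hθ0
  obtain ⟨σ₁, hσ₁, hRU⟩ := hRU a₀ θ₀ u₀ ha hθ hu ha0 hθ0
  refine ⟨min σ₁ (1 / 2), lt_min hσ₁ (by norm_num), fun σ hσ hσlt Φ τ hτ g hg hgb L hL A hA => ?_⟩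
  have hσ₁' : σ < σ₁ := hσlt.trans_le (min_le_left _ _)
  have hσ2 : σ ≤ 1 / 2 := (hσlt.trans_le (min_le_right _ _)).le
  obtain ⟨C, hCg⟩ := hgb
  have hC0 : 0 ≤ C := (abs_nonneg _).trans (hCg 0)
  have h2L : (0 : ℝ) < 2 * L := by positivity
  have h8L : (0 : ℝ) < 8 * L := by positivity
  -- RU at 2L: the deviation; RU at 8L: the first moment
  obtain ⟨c₁, hc₁, η₁, hη₁, N₁, hdev₁⟩ := hRU σ hσ hσ₁' Φ τ hτ g hg ⟨C, hCg⟩ (2 * L) h2L A hA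
  obtain ⟨c₂, hc₂, η₂, hη₂, N₂, hdev₂⟩ := hRU σ hσ hσ₁' Φ τ hτ g hg ⟨C, hCg⟩ (8 * L) h8L A hA
  have h8Linv : (0 : ℝ) < 1 / (8 * L) := by positivity
  obtain ⟨N₃, hN₃⟩ := exists_nat_const_mul_exp_neg_le (2 * C * (A + 1) * σ) hc₂ h8Linv
  refine ⟨c₁, hc₁, min η₁ η₂, lt_min hη₁ hη₂, max N₁ (max N₂ N₃),
    fun N hN h hh hhb hcut t₁ t₂ ht₁ h12 ht₂τ hlen z₀ hB => ?_⟩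
  have hN₁ : N₁ ≤ N := le_trans (le_max_left _ _) hN
  have hN₂' : N₂ ≤ N := le_trans ((le_max_left _ _).trans (le_max_right _ _)) hN
  have hN₃' : N₃ ≤ N := le_trans ((le_max_right _ _).trans (le_max_right _ _)) hN
  have hN0 : (0 : ℝ) ≤ (N : ℝ) + 1 := by positivity
  -- kept for η₁ and η₂
  have hfloor : ∀ η' : ℝ, min η₁ η₂ ≤ η' →
      ENNReal.ofReal (Real.exp (-(η' * ((N : ℝ) + 1)))) ≤
        localGibbsLaw σ a₀ u₀ θ₀ N (Φ N) {z | cellKey (rs N) (rs N) z = cellKey (rs N) (rs N) z₀} := by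
    intro η' hη'
    refine le_trans (ENNReal.ofReal_le_ofReal (Real.exp_le_exp.2 ?_)) hB
    nlinarith [mul_le_mul_of_nonneg_right hη' hN0]
  set ν : Measure (Phase N) := localGibbsLaw σ (fun _ => 1) (fun _ => 0) (fun _ => 1) N (Φ N) with hνdef
  set B : Set (Phase N) := {z | cellKey (rs N) (rs N) z = cellKey (rs N) (rs N) z₀} with hBdef
  set Z : Phase N → ℝ := slotSum (Φ N) τ (rs N) t₁ t₂ g h with hZdef
  have hBm : MeasurableSet B := measurableSet_cellKey_eq (rs N) (rs N) (cellKey (rs N) (rs N) z₀)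
  -- the first moment: |∫_B Z| ≤ (t_N/(2L)) ν(B)
  have hdev₂N := hdev₂ N hN₂' h hh hhb hcut t₁ t₂ ht₁ h12 ht₂τ hlen z₀ (hfloor η₂ (min_le_right _ _))
  have hmean := abs_setIntegral_slotSum_le_of_relDeviation hPM hσ hσ2 τ hA hlen hg hCg hh hhb hcut
    hBm h8L hdev₂N
  have htN := (tN_pos N).le
  have hG0 : 0 ≤ (ν B).toReal := ENNReal.toReal_nonneg
  have hmean' : |∫ z in B, Z z ∂ν| ≤ tN N / (2 * L) * (ν B).toReal := by
    refine hmean.trans ?_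
    have hcoef : 1 / (8 * L) + 2 * C * (A + 1) * σ * Real.exp (-(c₂ * ((N : ℝ) + 1))) ≤ 1 / (2 * L) := by
      have := hN₃ N hN₃'
      have h4 : 1 / (8 * L) + 1 / (8 * L) ≤ 1 / (2 * L) := by
        rw [← add_div, div_le_div_iff₀ h8L h2L]; nlinarith
      linarith
    calc _ ≤ 1 / (2 * L) * tN N * (ν B).toReal :=
          mul_le_mul_of_nonneg_right (mul_le_mul_of_nonneg_right hcoef htN) hG0
      _ = tN N / (2 * L) * (ν B).toReal := by ring
  -- hence |m_B| ≤ t_N/(2L)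
  set m : ℝ := (ν B).toReal⁻¹ * ∫ z in B, Z z ∂ν with hmdef
  have hm : |m| ≤ tN N / (2 * L) := by
    rcases eq_or_lt_of_le hG0 with h0 | hpos
    · rw [hmdef, ← h0, inv_zero, zero_mul, abs_zero]; positivity
    · rw [hmdef, abs_mul, abs_inv, abs_of_pos hpos]
      calc (ν B).toReal⁻¹ * |∫ z in B, Z z ∂ν| ≤ (ν B).toReal⁻¹ * (tN N / (2 * L) * (ν B).toReal) :=
            mul_le_mul_of_nonneg_left hmean' (inv_nonneg.2 hG0)
        _ = tN N / (2 * L) := by field_simp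
  -- inclusion of the deviation events
  have hsub : B ∩ {z | tN N / L < |Z z - m|} ⊆ B ∩ {z | tN N / (2 * L) < |Z z|} := by
    rintro z ⟨hzB, hz⟩
    refine ⟨hzB, ?_⟩
    simp only [mem_setOf_eq] at hz ⊢
    have h1 : |Z z - m| ≤ |Z z| + |m| := abs_sub _ _
    have h2 : tN N / L = tN N / (2 * L) + tN N / (2 * L) := by field_simp; ring
    linarith
  have hdev₁N := hdev₁ N hN₁ h hh hhb hcut t₁ t₂ ht₁ h12 ht₂τ hlen z₀ (hfloor η₁ (min_le_left _ _))
  exact (measure_mono hsub).trans hdev₁N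

end Summit.AtomisticToContinuum.HydrodynamicLimit.Theorems.KickFairRelEquilibriumMesoLine

end
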